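import Literature.Algebra.Module.PadicIntStructure
import Literature.NumberTheory.EllipticCurves.IwasawaAlgebraSpecializationCountProofs
import Mathlib.LinearAlgebra.Dimension.Torsion.Finite
import HarnessLib

/-!
# Reading the `ℤ_p`-rank and the torsion of a finitely generated `ℤ_p`-module off the counts
# `#(M ⧸ p^k M)` (crux ♭T≤ stmt-BirchSwinnertonDyer-23042 `DefectTransportModThreePT`, line
# `sigmacongruence`, brick (A1a) of the growth road to stub TS1′ `stub_twinStrictSurj`)

Route `UniversalToricDescent`, lead prover `bsd-wall-utd-p1` g16. THEOREMS ONLY (no definition, no named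
fact, no `sorry`); `--supports stmt-BirchSwinnertonDyer-23042`. BSD is not proved by any of this.

For a finitely generated `ℤ_p`-module `M ≅ ℤ_p^a ⊕ T` (`T` finite, tree theorem
`Literature.Algebra.Module.PadicInt.exists_linearEquiv_prod_finite`):

* `finrank_eq_zero_of_finite`, `finrank_eq_of_linearEquiv_prod_finite` — `rank_{ℤ_p} T = 0`, `rank_{ℤ_p} M = a`;
* `natCard_quotient_span_pow_smul_top_eq` — `#(M ⧸ p^k M) = p^{k a} · #(T ⧸ p^k T)`;
* `pow_smul_eq_zero_of_natCard_le` — a finite `ℤ_p`-module of order `≤ p^b` is killed by `p^b`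
  (the cyclic submodule `ℤ_p t ≅ ℤ_p/(p^j)` has `p^j ≤ p^b` elements);
* `finite_of_finrank_eq_zero` — `rank_{ℤ_p} M = 0 ⟹ M` finite;
* **`finrank_eq_and_natCard_torsion_le_of_card_quotient_bounds`** — if `p^{s k} ≤ p^b · #(M ⧸ p^k M)` and
  `#(M ⧸ p^k M) ≤ p^{s k + b}` for all `k`, then `rank_{ℤ_p} M = s` and `#M_tors ≤ p^b` (so `p^b M_tors = 0`,
  `pow_smul_eq_zero_of_mem_torsion_of_card_quotient_bounds`).

This is the `ℤ_p`-level input of the torsion-freeness criterion for `Λ`-modules by two-sided uniform counts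
(`…TorsionFreeByCount`): two-sided control of `#(Q ⧸ (p^k, ω_n)Q)` pins the `ℤ_p`-rank of `Q/ω_n Q` to its generic
value and bounds its torsion uniformly.

References: [Washington1997] §13.2 (Lemma 13.7, Prop. 13.8, Thm. 13.12 and the counting after it);
[GreenbergLNM1716] §1 p. 60 (reading `Λ`-structure off `#X/(p^k, ω_n)X`).
-/

-- the Theorems namespace of this sub repeats the summit name by design (D-0017 nested layout)
set_option linter.dupNamespace false

namespace Summit.BirchSwinnertonDyer.BirchSwinnertonDyer.Theorems.UniversalToricDescentTorsionFreeByCount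

open Submodule Literature.NumberTheory.EllipticCurves

variable (p : ℕ) [hp : Fact p.Prime]

/-- A finite `ℤ_p`-module has `ℤ_p`-rank `0` (it is torsion: `#T · t = 0`). [folklore] -/
theorem finrank_eq_zero_of_finite (T : Type*) [AddCommGroup T] [Module ℤ_[p] T] [Finite T] :
    Module.finrank ℤ_[p] T = 0 := by
  refine Module.finrank_eq_zero_iff_isTorsion.mpr fun t => ?_
  refine ⟨⟨(Nat.card T : ℤ_[p]), mem_nonZeroDivisors_of_ne_zero
    (Nat.cast_ne_zero.mpr Nat.card_pos.ne')⟩, ?_⟩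
  rw [Submonoid.mk_smul, Nat.cast_smul_eq_nsmul, card_nsmul_eq_zero']

/-- `rank_{ℤ_p} M = a` for `M ≅ ℤ_p^a ⊕ T` with `T` finite. [folklore] -/
theorem finrank_eq_of_linearEquiv_prod_finite {M : Type*} [AddCommGroup M] [Module ℤ_[p] M]
    {a : ℕ} {T : Type*} [AddCommGroup T] [Module ℤ_[p] T] [Finite T]
    (e : M ≃ₗ[ℤ_[p]] (Fin a → ℤ_[p]) × T) : Module.finrank ℤ_[p] M = a := by
  rw [e.finrank_eq]
  have h := Submodule.finrank_quotient_add_finrank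
    (LinearMap.ker (LinearMap.fst ℤ_[p] (Fin a → ℤ_[p]) T))
  rw [((LinearMap.fst ℤ_[p] (Fin a → ℤ_[p]) T).quotKerEquivOfSurjective
      Prod.fst_surjective).finrank_eq, Module.finrank_fintype_fun_eq_card, Fintype.card_fin,
    LinearMap.ker_fst, LinearMap.finrank_range_of_inj LinearMap.inr_injective,
    finrank_eq_zero_of_finite p T, add_zero] at h
  exact h.symm

/-- `#(M ⧸ p^k M) = p^{k a} · #(T ⧸ p^k T)` for `M ≅ ℤ_p^a ⊕ T`. [cite: Washington1997, §13.2 (Lemma 13.7,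
Prop. 13.8)] -/
theorem natCard_quotient_span_pow_smul_top_eq {M : Type*} [AddCommGroup M] [Module ℤ_[p] M]
    {a : ℕ} {T : Type*} [AddCommGroup T] [Module ℤ_[p] T]
    (e : M ≃ₗ[ℤ_[p]] (Fin a → ℤ_[p]) × T) (k : ℕ) :
    Nat.card (M ⧸ (Ideal.span {(p : ℤ_[p]) ^ k} • ⊤ : Submodule ℤ_[p] M)) =
      p ^ (k * a) * Nat.card (T ⧸ (Ideal.span {(p : ℤ_[p]) ^ k} • ⊤ : Submodule ℤ_[p] T)) := by
  rw [Module.card_quotSMulTop_eq_of_linearEquiv _ e, Module.card_prod_quotSMulTop,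
    IwasawaAlgebra.card_quotSMulTop_pow_of_free p (Fin a → ℤ_[p]) k,
    Module.finrank_fintype_fun_eq_card, Fintype.card_fin]

/-- **A finite `ℤ_p`-module of order `≤ p^b` is killed by `p^b`**: the annihilator of `t` is `(p^j)` and
`ℤ_p t ≅ ℤ_p/(p^j)` has `p^j ≤ #T ≤ p^b` elements. [folklore] -/
theorem pow_smul_eq_zero_of_natCard_le {T : Type*} [AddCommGroup T] [Module ℤ_[p] T] [Finite T]
    {b : ℕ} (hT : Nat.card T ≤ p ^ b) (t : T) : (p : ℤ_[p]) ^ b • t = 0 := by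
  have ht : Ideal.torsionOf ℤ_[p] T t ≠ ⊥ := by
    intro h0
    have hmem : (Nat.card T : ℤ_[p]) ∈ Ideal.torsionOf ℤ_[p] T t := by
      rw [Ideal.mem_torsionOf_iff, Nat.cast_smul_eq_nsmul, card_nsmul_eq_zero']
    rw [h0, Ideal.mem_bot] at hmem
    exact (Nat.cast_ne_zero.mpr Nat.card_pos.ne') hmem
  obtain ⟨j, hj⟩ := IsDiscreteValuationRing.ideal_eq_span_pow_irreducible ht
    (PadicInt.irreducible_p (p := p))
  have hcard : Nat.card (span ℤ_[p] {t}) = p ^ j := by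
    rw [← Nat.card_congr (Ideal.quotTorsionOfEquivSpanSingleton ℤ_[p] T t).toEquiv,
      Nat.card_congr (Ideal.quotEquivOfEq hj).toEquiv, ← PadicInt.ker_toZModPow,
      Nat.card_congr (RingHom.quotientKerEquivOfSurjective
        (ZMod.ringHom_surjective (PadicInt.toZModPow j))).toEquiv, Nat.card_zmod]
  have hjb : j ≤ b := by
    have h1 : p ^ j ≤ p ^ b :=
      hcard ▸ (Nat.card_le_card_of_injective _ (span ℤ_[p] {t}).subtype_injective).trans hT
    exact (Nat.pow_le_pow_iff_right hp.out.one_lt).mp h1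
  have hjt : (p : ℤ_[p]) ^ j • t = 0 :=
    (Ideal.mem_torsionOf_iff t _).mp (hj ▸ Ideal.mem_span_singleton_self _)
  rw [← Nat.sub_add_cancel hjb, pow_add, mul_smul, hjt, smul_zero]

/-- A finitely generated `ℤ_p`-module of `ℤ_p`-rank `0` is finite (`M ≅ ℤ_p^0 ⊕ T`). [folklore] -/
theorem finite_of_finrank_eq_zero (M : Type*) [AddCommGroup M] [Module ℤ_[p] M]
    [Module.Finite ℤ_[p] M] (h : Module.finrank ℤ_[p] M = 0) : Finite M := by
  obtain ⟨a, T, _, _, _, ⟨e⟩⟩ := Literature.Algebra.Module.PadicInt.exists_linearEquiv_prod_finite p M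
  have ha : a = 0 := by rw [← finrank_eq_of_linearEquiv_prod_finite p e, h]
  subst ha
  exact Finite.of_equiv _ e.toEquiv.symm

/-- **Two-sided counts `p^{s k} ≤ p^b · #(M ⧸ p^k M)` and `#(M ⧸ p^k M) ≤ p^{s k + b}` for all `k` force
`rank_{ℤ_p} M = s` and `#M_tors ≤ p^b`.**  With `M ≅ ℤ_p^a ⊕ T`: `#(M/p^kM) = p^{ka} · #(T/p^kT)`, and
`1 ≤ #(T/p^kT) ≤ #T` with equality for `p^k T = 0`; the two bounds for all `k` give `a = s`, then `#T ≤ p^b`,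
and `M_tors ↪ T`. [cite: Washington1997, §13.2 (Prop. 13.8, Thm. 13.12 and the estimates `#X/ν_n X`)] -/
theorem finrank_eq_and_natCard_torsion_le_of_card_quotient_bounds {M : Type*} [AddCommGroup M]
    [Module ℤ_[p] M] [Module.Finite ℤ_[p] M] (s b : ℕ)
    (hlow : ∀ k, p ^ (s * k) ≤
      p ^ b * Nat.card (M ⧸ (Ideal.span {(p : ℤ_[p]) ^ k} • ⊤ : Submodule ℤ_[p] M)))
    (hup : ∀ k, Nat.card (M ⧸ (Ideal.span {(p : ℤ_[p]) ^ k} • ⊤ : Submodule ℤ_[p] M)) ≤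
      p ^ (s * k + b)) :
    Module.finrank ℤ_[p] M = s ∧ Finite (torsion ℤ_[p] M) ∧ Nat.card (torsion ℤ_[p] M) ≤ p ^ b := by
  obtain ⟨a, T, _, _, _, ⟨e⟩⟩ := Literature.Algebra.Module.PadicInt.exists_linearEquiv_prod_finite p M
  have hp1 : 1 < p := hp.out.one_lt
  have hrank := finrank_eq_of_linearEquiv_prod_finite p e
  have hcount := natCard_quotient_span_pow_smul_top_eq p e
  -- the torsion counts `t k = #(T ⧸ p^k T)`
  haveI : ∀ k, Finite (T ⧸ (Ideal.span {(p : ℤ_[p]) ^ k} • ⊤ : Submodule ℤ_[p] T)) :=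
    fun k => Finite.of_surjective _ (Submodule.mkQ_surjective _)
  have ht_pos : ∀ k, 1 ≤ Nat.card (T ⧸ (Ideal.span {(p : ℤ_[p]) ^ k} • ⊤ : Submodule ℤ_[p] T)) :=
    fun k => Nat.card_pos
  have ht_le : ∀ k, Nat.card (T ⧸ (Ideal.span {(p : ℤ_[p]) ^ k} • ⊤ : Submodule ℤ_[p] T)) ≤
      Nat.card T := fun k => Nat.card_le_card_of_surjective _ (Submodule.mkQ_surjective _)
  have hTlt : Nat.card T < p ^ Nat.card T := Nat.lt_pow_self hp1
  -- `a ≤ s`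
  have h1 : ∀ k, k * a ≤ s * k + b := fun k => by
    have := hup k
    rw [hcount] at this
    exact (Nat.pow_le_pow_iff_right hp1).mp
      ((Nat.le_mul_of_pos_right _ (ht_pos k)).trans this)
  have has : a ≤ s := by
    by_contra h
    have := h1 (b + 1)
    nlinarith
  -- `s ≤ a`
  have h2 : ∀ k, s * k ≤ b + k * a + Nat.card T := fun k => by
    have := hlow k
    rw [hcount] at this
    have h3 : p ^ (s * k) ≤ p ^ (b + k * a + Nat.card T) := by
      calc p ^ (s * k) ≤ p ^ b * (p ^ (k * a) * Nat.card T) :=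
            this.trans (Nat.mul_le_mul_left _ (Nat.mul_le_mul_left _ (ht_le k)))
        _ ≤ p ^ b * (p ^ (k * a) * p ^ Nat.card T) :=
            Nat.mul_le_mul_left _ (Nat.mul_le_mul_left _ hTlt.le)
        _ = p ^ (b + k * a + Nat.card T) := by rw [pow_add, pow_add, mul_assoc]
    exact (Nat.pow_le_pow_iff_right hp1).mp h3
  have hsa : s ≤ a := by
    by_contra h
    have := h2 (b + Nat.card T + 1)
    nlinarith
  have hae : a = s := le_antisymm has hsa
  -- `#T ≤ p^b`: take `k₀` with `p^{k₀} T = 0`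
  have hkill : ∀ t : T, (p : ℤ_[p]) ^ Nat.card T • t = 0 :=
    pow_smul_eq_zero_of_natCard_le p hTlt.le
  have hbot : (Ideal.span {(p : ℤ_[p]) ^ Nat.card T} • ⊤ : Submodule ℤ_[p] T) = ⊥ := by
    rw [Submodule.ideal_span_singleton_smul, eq_bot_iff]
    intro x hx
    obtain ⟨y, -, rfl⟩ := (Submodule.mem_smul_pointwise_iff_exists _ _ _).mp hx
    exact (Submodule.mem_bot ℤ_[p]).mpr (hkill y)
  have hTcard : Nat.card T ≤ p ^ b := by
    have := hup (Nat.card T)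
    rw [hcount, Nat.card_congr (Submodule.quotEquivOfEqBot _ hbot).toEquiv, hae, pow_add,
      mul_comm (Nat.card T) s] at this
    exact Nat.le_of_mul_le_mul_left this (Nat.pow_pos hp.out.pos)
  -- `M_tors ↪ T`
  have hinj : Function.Injective (fun x : torsion ℤ_[p] M => (e x).2) := by
    intro x y hxy
    apply Subtype.ext
    apply e.injective
    have hx2 : (e x).2 = (e y).2 := hxy
    obtain ⟨⟨c, hc⟩, hcx⟩ := (x - y).2
    have hc0 : c ≠ 0 := nonZeroDivisors.ne_zero hc
    have hcx' : c • ((x : M) - y) = 0 := by simpa [Submonoid.mk_smul] using hcx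
    have h0 : c • (e ((x : M) - y)).1 = 0 := by
      rw [← Prod.smul_fst, ← LinearEquiv.map_smul, hcx', map_zero, Prod.fst_zero]
    have hfst : (e ((x : M) - y)).1 = 0 :=
      ((Module.isTorsionFree_iff_smul_eq_zero.mp inferInstance) c _ h0).resolve_left hc0
    have hsub : e (x : M) - e (y : M) = 0 := by
      rw [← map_sub]
      exact Prod.ext (by simpa using hfst) (by simp [hx2])
    exact sub_eq_zero.mp hsub
  haveI : Finite (torsion ℤ_[p] M) := Finite.of_injective _ hinj
  exact ⟨hrank.trans hae, this, (Nat.card_le_card_of_injective _ hinj).trans hTcard⟩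

/-- **Under the two-sided counts, `p^b` kills every torsion element of `M`.** [cite: Washington1997, §13.2] -/
theorem pow_smul_eq_zero_of_mem_torsion_of_card_quotient_bounds {M : Type*} [AddCommGroup M]
    [Module ℤ_[p] M] [Module.Finite ℤ_[p] M] (s b : ℕ)
    (hlow : ∀ k, p ^ (s * k) ≤
      p ^ b * Nat.card (M ⧸ (Ideal.span {(p : ℤ_[p]) ^ k} • ⊤ : Submodule ℤ_[p] M)))
    (hup : ∀ k, Nat.card (M ⧸ (Ideal.span {(p : ℤ_[p]) ^ k} • ⊤ : Submodule ℤ_[p] M)) ≤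
      p ^ (s * k + b)) {x : M} (hx : x ∈ torsion ℤ_[p] M) : (p : ℤ_[p]) ^ b • x = 0 := by
  obtain ⟨-, hfin, hcard⟩ := finrank_eq_and_natCard_torsion_le_of_card_quotient_bounds p s b hlow hup
  haveI := hfin
  have := pow_smul_eq_zero_of_natCard_le p hcard (⟨x, hx⟩ : torsion ℤ_[p] M)
  simpa using congrArg Subtype.val this

end Summit.BirchSwinnertonDyer.BirchSwinnertonDyer.Theorems.UniversalToricDescentTorsionFreeByCount
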